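/-
Copyright (c) 2026 the pub-hodgecm-mathlib formalisation cell (harness21).  Prover seat hodgecm-mathlib-K2Liu-p01 (g8), Track B «K2-LIT»,
#184♮ = hLiu418 = `stmt-HodgeConjecture-24832`; #42S organ S1 ROAD W, F7 `K2LiuLocalSWParityOscillation` (RULINGS «M-158a» (2), «M-158b» (1) (q1)–(q2)), organ lead K2Liu-p06 (g4)
SPEC-S1-AssemblySocket §2 row `hsum`; my CENSUS-F7-ProfileSumTransport (d5aeea8ad1f9d314) file (T2): the CELL-VOLUME COUNT `μ(A) = #(A ⧸ P)·μ(P)` (generic).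
-/
import Mathlib.MeasureTheory.Group.Measure
import Mathlib.MeasureTheory.Integral.Bochner.Set
import Mathlib.GroupTheory.QuotientGroup.Basic
import HarnessLib

/-!
# Crux `HLiu418`, #42S-S1 ROAD W, file (T2): THE CELL-VOLUME COUNT — a union of cosets of a measurable subgroup `P` has measure `#(classes)·μ(P)`
# (representative-free: the classes are a `Finset` of `X ⧸ P`, or the image of a `P`-saturated set)

Cell `hodgecm-mathlib`, crux item hLiu418 = `stmt-HodgeConjecture-24832` (helper lane `--supports … --as helper`, count-neutral).  THEOREMS ONLY (no `def`, no instance,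
no notation, no named-fact hypothesis, no `sorry`).  GENERIC (any additive group with a left-invariant measure): the step «volume = count × cell volume» of the organ's
transport `T^ε(m) = q^{4m}·vol{…} = N_m∕q^{8m}` (RULING «M-158b» (q2): counts on model coordinates BY VALUE, volumes by this file), common to F7∕F7r∕F8; companion of
★ (T1) `K2LiuProfileSumCharacterOrthogonality` (the integral `∫ 𝟙_D φ dμ` it leaves) and representative-free twin of ★ `K2LiuResidueCharacterCosets.setIntegral_eq_sum_cosets`.
* §1 the fibres of `X → X ⧸ P`: `preimage_mk_singleton_mk` (`= (−x + ·)⁻¹ P`, a translate of the cell), `measurableSet_preimage_mk_singleton`, `measure_preimage_mk_singleton` (`= μ P`).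
* §2 **`measure_preimage_mk_finset`**: `μ(mk⁻¹ C) = #C · μ(P)` for a finite set `C` of classes; **`measure_eq_natCard_mul_of_saturated`**: for a `P`-SATURATED set `A`
  (`a ∈ A, p ∈ P ⇒ a + p ∈ A`) with finitely many classes, `μ(A) = Nat.card (mk '' A) · μ(P)`; `measurableSet_of_saturated`.
* §3 the real∕complex forms the witness files consume: `measureReal_eq_natCard_mul_of_saturated`, **`integral_indicator_one_eq_natCard_mul`** (`∫ 𝟙_A dμ = Nat.card (mk '' A) · μ.real P` in `ℂ`).
[Tate1950, §2.2 Lemma 2.2.5] [Weil1965, n° 41 (volumes of lattice cosets)] [Shimura1997, §13.2 (local densities as limits of coset counts)].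
HONEST LABEL.  Count-neutral helper; `HC_CM` is proved only modulo the 7 printed citations (2 remaining named inputs: hLiu418 = `stmt-HodgeConjecture-24832`,
h413 = `stmt-HodgeConjecture-24833`) until rung 0 closes.  NOT here: which cells (the frame step (T3)) and the count itself (★ F7b-inst `natCard_solutions_eq`).

## References
* [Tate1950] J. Tate, *Fourier analysis in number fields and Hecke's zeta-functions* (1950), §2.2.
* [Weil1965] A. Weil, *Sur la formule de Siegel dans la théorie des groupes classiques*, Acta Math. 113 (1965), n° 41.
* [Shimura1997] G. Shimura, *Euler products and Eisenstein series*, CBMS 93 (1997), §13.2.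
-/

set_option autoImplicit false
set_option linter.dupNamespace false -- the mandated namespace repeats `HodgeConjecture.HodgeConjecture`

open MeasureTheory Finset
open scoped Classical ENNReal

namespace Summit.HodgeConjecture.HodgeConjecture.Cruxes.HLiu418.K2LiuLatticeCellVolumeCount

variable {X : Type*} [AddCommGroup X] (P : AddSubgroup X)

/-! ## §1 The fibres of `X → X ⧸ P` are translates of the cell -/

/-- the fibre over the class of `x` is the translate `{y : −x + y ∈ P} = (−x + ·)⁻¹ P`… written as the preimage of `P` under `y ↦ −x + y`. [folklore] -/
theorem preimage_mk_singleton_mk (x : X) :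
    (QuotientAddGroup.mk : X → X ⧸ P) ⁻¹' {QuotientAddGroup.mk x} = (fun y => -x + y) ⁻¹' (P : Set X) := by
  ext y
  rw [Set.mem_preimage, Set.mem_singleton_iff, Set.mem_preimage, SetLike.mem_coe, eq_comm, QuotientAddGroup.eq]

/-- every class is the class of its representative: the fibre over `c` is `(−c.out + ·)⁻¹ P`. [folklore] -/
theorem preimage_mk_singleton (c : X ⧸ P) :
    (QuotientAddGroup.mk : X → X ⧸ P) ⁻¹' {c} = (fun y => -c.out + y) ⁻¹' (P : Set X) := by
  conv_lhs => rw [← QuotientAddGroup.out_eq' c]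
  exact preimage_mk_singleton_mk P c.out

variable [MeasurableSpace X]

/-- the fibres are measurable when the cell is (translation is measurable). [folklore] -/
theorem measurableSet_preimage_mk_singleton [MeasurableAdd X] (hP : MeasurableSet (P : Set X)) (c : X ⧸ P) :
    MeasurableSet ((QuotientAddGroup.mk : X → X ⧸ P) ⁻¹' {c}) := by
  rw [preimage_mk_singleton]
  exact (measurable_const_add (-c.out)) hP

/-- the preimage of any set of classes is measurable when the cell is (countability is not needed: we only use finite sets of classes below, but the fibrewise
statement is recorded for finite unions). [folklore] -/
theorem measurableSet_preimage_mk_finset [MeasurableAdd X] (hP : MeasurableSet (P : Set X)) (C : Finset (X ⧸ P)) :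
    MeasurableSet ((QuotientAddGroup.mk : X → X ⧸ P) ⁻¹' (C : Set (X ⧸ P))) := by
  have e : ((QuotientAddGroup.mk : X → X ⧸ P) ⁻¹' (C : Set (X ⧸ P))) = ⋃ c ∈ C, (QuotientAddGroup.mk : X → X ⧸ P) ⁻¹' {c} := by
    ext y
    simp only [Set.mem_preimage, mem_coe, Set.mem_iUnion, Set.mem_singleton_iff, exists_prop, exists_eq_right']
  rw [e]
  exact MeasurableSet.biUnion (Finset.countable_toSet C) fun c _ => measurableSet_preimage_mk_singleton P hP c

/-- **each fibre has the measure of the cell** (left invariance). [cite: Tate1950, §2.2 Lemma 2.2.5] -/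
theorem measure_preimage_mk_singleton [MeasurableAdd X] (μ : Measure X) [μ.IsAddLeftInvariant] (c : X ⧸ P) :
    μ ((QuotientAddGroup.mk : X → X ⧸ P) ⁻¹' {c}) = μ P := by
  rw [preimage_mk_singleton, measure_preimage_add]

/-! ## §2 Volume = number of classes × cell volume -/

/-- **`μ(mk⁻¹ C) = #C · μ(P)`** for a finite set `C` of classes (disjoint union of `#C` translates of the cell). [cite: Tate1950, §2.2 Lemma 2.2.5] [cite: Weil1965, n° 41] -/
theorem measure_preimage_mk_finset [MeasurableAdd X] (μ : Measure X) [μ.IsAddLeftInvariant] (hP : MeasurableSet (P : Set X)) (C : Finset (X ⧸ P)) :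
    μ ((QuotientAddGroup.mk : X → X ⧸ P) ⁻¹' (C : Set (X ⧸ P))) = (C.card : ℝ≥0∞) * μ P := by
  have e : ((QuotientAddGroup.mk : X → X ⧸ P) ⁻¹' (C : Set (X ⧸ P))) = ⋃ c ∈ C, (QuotientAddGroup.mk : X → X ⧸ P) ⁻¹' {c} := by
    ext y
    simp only [Set.mem_preimage, mem_coe, Set.mem_iUnion, Set.mem_singleton_iff, exists_prop, exists_eq_right']
  rw [e, measure_biUnion_finset]
  · simp only [measure_preimage_mk_singleton P μ, sum_const, nsmul_eq_mul]
  · intro c _ c' _ hcc'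
    exact Disjoint.preimage _ (Set.disjoint_singleton.2 hcc')
  · exact fun c _ => measurableSet_preimage_mk_singleton P hP c

omit [MeasurableSpace X] in
/-- a `P`-SATURATED set is the preimage of its set of classes. [folklore] -/
theorem eq_preimage_image_of_saturated {A : Set X} (hA : ∀ a ∈ A, ∀ p ∈ P, a + p ∈ A) :
    A = (QuotientAddGroup.mk : X → X ⧸ P) ⁻¹' ((QuotientAddGroup.mk : X → X ⧸ P) '' A) := by
  ext y
  simp only [Set.mem_preimage, Set.mem_image]
  constructor
  · exact fun hy => ⟨y, hy, rfl⟩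
  · rintro ⟨a, ha, hay⟩
    rw [QuotientAddGroup.eq] at hay
    have e : y = a + (-a + y) := by abel
    rw [e]
    exact hA a ha _ hay

/-- a saturated set with finitely many classes is measurable when the cell is. [folklore] -/
theorem measurableSet_of_saturated [MeasurableAdd X] (hP : MeasurableSet (P : Set X)) {A : Set X} (hA : ∀ a ∈ A, ∀ p ∈ P, a + p ∈ A)
    (hfin : ((QuotientAddGroup.mk : X → X ⧸ P) '' A).Finite) : MeasurableSet A := by
  rw [eq_preimage_image_of_saturated P hA, ← hfin.coe_toFinset]
  exact measurableSet_preimage_mk_finset P hP _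

/-- **VOLUME = COUNT × CELL VOLUME**: for a `P`-saturated set `A` with finitely many classes, `μ(A) = Nat.card (mk '' A) · μ(P)`.
[cite: Tate1950, §2.2 Lemma 2.2.5] [cite: Weil1965, n° 41] [cite: Shimura1997, §13.2] -/
theorem measure_eq_natCard_mul_of_saturated [MeasurableAdd X] (μ : Measure X) [μ.IsAddLeftInvariant] (hP : MeasurableSet (P : Set X)) {A : Set X}
    (hA : ∀ a ∈ A, ∀ p ∈ P, a + p ∈ A) (hfin : ((QuotientAddGroup.mk : X → X ⧸ P) '' A).Finite) :
    μ A = (Nat.card ((QuotientAddGroup.mk : X → X ⧸ P) '' A) : ℝ≥0∞) * μ P := by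
  conv_lhs => rw [eq_preimage_image_of_saturated P hA, ← hfin.coe_toFinset]
  rw [measure_preimage_mk_finset P μ hP, ← Nat.card_eq_card_finite_toFinset hfin]

/-! ## §3 Real and complex forms -/

/-- `μ.real` form of `measure_eq_natCard_mul_of_saturated`. [cite: Tate1950, §2.2 Lemma 2.2.5] -/
theorem measureReal_eq_natCard_mul_of_saturated [MeasurableAdd X] (μ : Measure X) [μ.IsAddLeftInvariant] (hP : MeasurableSet (P : Set X)) {A : Set X}
    (hA : ∀ a ∈ A, ∀ p ∈ P, a + p ∈ A) (hfin : ((QuotientAddGroup.mk : X → X ⧸ P) '' A).Finite) :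
    μ.real A = (Nat.card ((QuotientAddGroup.mk : X → X ⧸ P) '' A) : ℝ) * μ.real P := by
  rw [measureReal_def, measure_eq_natCard_mul_of_saturated P μ hP hA hfin, ENNReal.toReal_mul, ENNReal.toReal_natCast, measureReal_def]

/-- **`∫ 𝟙_A dμ = Nat.card (mk '' A) · μ.real P`** (complex-valued indicator, as the witness files integrate `ℂ`-valued profiles).
[cite: Tate1950, §2.2 Lemma 2.2.5] [cite: Shimura1997, §13.2] -/
theorem integral_indicator_one_eq_natCard_mul [MeasurableAdd X] (μ : Measure X) [μ.IsAddLeftInvariant] (hP : MeasurableSet (P : Set X)) {A : Set X}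
    (hA : ∀ a ∈ A, ∀ p ∈ P, a + p ∈ A) (hfin : ((QuotientAddGroup.mk : X → X ⧸ P) '' A).Finite) :
    ∫ x, A.indicator (fun _ => (1 : ℂ)) x ∂μ = (Nat.card ((QuotientAddGroup.mk : X → X ⧸ P) '' A) : ℂ) * (μ.real P : ℂ) := by
  rw [integral_indicator_const (1 : ℂ) (measurableSet_of_saturated P hP hA hfin), measureReal_eq_natCard_mul_of_saturated P μ hP hA hfin]
  simp only [Complex.real_smul, mul_one, Complex.ofReal_mul, Complex.ofReal_natCast]

omit [MeasurableSpace X] in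
/-- the DIFFERENCE OF TWO SATURATED SETS (the lattice pair `(S₁)² ⊇ (S₂)²` of the witness, cut by the same condition) is saturated. [folklore] -/
theorem diff_saturated {A B : Set X} (hA : ∀ a ∈ A, ∀ p ∈ P, a + p ∈ A) (hB : ∀ a ∈ B, ∀ p ∈ P, a + p ∈ B) :
    ∀ a ∈ A \ B, ∀ p ∈ P, a + p ∈ A \ B := by
  intro a ha p hp
  refine ⟨hA a ha.1 p hp, fun h => ha.2 ?_⟩
  have e : a = a + p + -p := by abel
  rw [e]
  exact hB _ h _ (P.neg_mem hp)

omit [MeasurableSpace X] in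
/-- the INTERSECTION of two saturated sets (a lattice box cut by a saturated condition) is saturated. [folklore] -/
theorem inter_saturated {A B : Set X} (hA : ∀ a ∈ A, ∀ p ∈ P, a + p ∈ A) (hB : ∀ a ∈ B, ∀ p ∈ P, a + p ∈ B) :
    ∀ a ∈ A ∩ B, ∀ p ∈ P, a + p ∈ A ∩ B :=
  fun a ha p hp => ⟨hA a ha.1 p hp, hB a ha.2 p hp⟩

omit [MeasurableSpace X] in
/-- a set defined by a condition that is INVARIANT under `P` is saturated. [folklore] -/
theorem saturated_of_invariant {Q : X → Prop} (hQ : ∀ a, ∀ p ∈ P, Q a → Q (a + p)) : ∀ a ∈ {a | Q a}, ∀ p ∈ P, a + p ∈ {a | Q a} :=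
  fun a ha p hp => hQ a p hp ha

end Summit.HodgeConjecture.HodgeConjecture.Cruxes.HLiu418.K2LiuLatticeCellVolumeCount
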